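import Summits.RiemannHypothesis.RiemannHypothesis.Theorems.JensenPolynomialsCapCertCompute

/-!
# Route `JensenPolynomials` — `XiCumulantMajorantCap` kernel packaging, part 2: soundness of the fixed-point primitives

RH-FREE, γ-FREE proof-of-data for the numeric route child `XiCumulantMajorantCap` (stmt-RiemannHypothesis-19217) of
route `JensenPolynomials` (rung J-P(P1′), cell rh-jensen, engine target ET1 «C2GEN-CERT»). Nothing here bears on the truth of RH.
Upward-rounding lemmas for `cdiv`, `mulU`, `ofRatU`, `powU`, the run-time-checked square roots `sqrtU`/`sqrtD`, the
tangent bound `sqrtTangU`, and random access into the memo tables `btListx`, `etTab` (all reals are `n/ONE`).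
-/

-- D-0017: `Summit.RiemannHypothesis.RiemannHypothesis.…` duplicates the namespace BY DESIGN (single-problem summit).
set_option linter.dupNamespace false

namespace Summit.RiemannHypothesis.RiemannHypothesis.Theorems.JensenPolynomials.CapCert

open Finset Real
open Summit.RiemannHypothesis.RiemannHypothesis.Theorems.JensenPolynomials
open Finset Real

/-- The three facts about the fixed-point unit used throughout: `0 < ONE` as a real, `ONE ≠ 0` as a real, `0 < ONE` in `ℕ`. -/
theorem ONE_facts : (0 : ℝ) < (ONE : ℝ) ∧ (ONE : ℝ) ≠ 0 ∧ 0 < ONE := by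
  refine ⟨?_, ?_, ?_⟩ <;> (unfold ONE prec; positivity)

/-- Ceiling division is an upper bound: `a ≤ cdiv a b * b`. -/
theorem le_cdiv_mul (a b : ℕ) (hb : 0 < b) : a ≤ cdiv a b * b := by
  unfold cdiv
  have h1 := Nat.div_add_mod (a + b - 1) b
  have h2 := Nat.mod_lt (a + b - 1) hb
  have h3 : b * ((a + b - 1) / b) + (a + b - 1) % b = a + b - 1 := h1
  have : a ≤ b * ((a + b - 1) / b) := by omega
  simpa [Nat.mul_comm] using this

/-- Ceiling division is an upper bound (real form). -/
theorem div_le_cdiv (a b : ℕ) (hb : 0 < b) : (a : ℝ) / b ≤ (cdiv a b : ℝ) := by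
  have hb' : (0 : ℝ) < b := by exact_mod_cast hb
  rw [div_le_iff₀ hb']
  exact_mod_cast le_cdiv_mul a b hb

/-- Soundness of `ofRatU`. -/
theorem ofRatU_ge (p q : ℕ) (hq : 0 < q) : (p : ℝ) / q ≤ (ofRatU p q : ℝ) / ONE := by
  unfold ofRatU
  rw [le_div_iff₀ ONE_facts.1]
  have := div_le_cdiv (p * ONE) q hq
  calc (p : ℝ) / q * ONE = ((p * ONE : ℕ) : ℝ) / q := by push_cast; ring
    _ ≤ _ := this

/-- Soundness of `mulU`. -/
theorem mulU_ge {a b : ℕ} {u v : ℝ} (hu : 0 ≤ u) (hv : 0 ≤ v) (ha : u ≤ (a : ℝ) / ONE)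
    (hb : v ≤ (b : ℝ) / ONE) : u * v ≤ (mulU a b : ℝ) / ONE := by
  unfold mulU
  have h1 : u * v ≤ (a : ℝ) / ONE * ((b : ℝ) / ONE) :=
    mul_le_mul ha hb hv (hu.trans ha)
  have h2 : (a : ℝ) / ONE * ((b : ℝ) / ONE) = ((a * b : ℕ) : ℝ) / ONE / ONE := by
    push_cast; field_simp
  have h3 := div_le_cdiv (a * b) ONE (by unfold ONE; positivity)
  rw [h2] at h1
  calc u * v ≤ ((a * b : ℕ) : ℝ) / ONE / ONE := h1
    _ ≤ (cdiv (a * b) ONE : ℝ) / ONE := by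
        rw [div_le_div_iff_of_pos_right ONE_facts.1]; exact h3

/-- Values of fixed-point numbers are nonnegative. -/
theorem fp_nonneg (a : ℕ) : (0 : ℝ) ≤ (a : ℝ) / ONE := div_nonneg (Nat.cast_nonneg _) ONE_facts.1.le

/-- Soundness of `powU`. -/
theorem powU_ge {a : ℕ} {u : ℝ} (hu : 0 ≤ u) (ha : u ≤ (a : ℝ) / ONE) :
    ∀ n, u ^ n ≤ (powU a n : ℝ) / ONE := by
  intro n
  induction n with
  | zero => simp only [powU, pow_zero]; rw [div_self ONE_facts.2.1]
  | succ n ih =>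
    rw [pow_succ]
    exact mulU_ge (pow_nonneg hu n) hu ih ha

/-- `√(a/ONE) = √(a·ONE)/ONE`. -/
theorem sqrt_fp (a : ℕ) : √((a : ℝ) / ONE) = √(((a * ONE : ℕ) : ℝ)) / ONE := by
  have : (a : ℝ) / ONE = ((a * ONE : ℕ) : ℝ) / ((ONE : ℝ) * ONE) := by
    push_cast; field_simp
  rw [this, Real.sqrt_div' _ (mul_nonneg ONE_facts.1.le ONE_facts.1.le), Real.sqrt_mul_self ONE_facts.1.le]

/-- Soundness of `sqrtU`: an upper bound of the square root. -/
theorem sqrtU_ge {a : ℕ} {u : ℝ} (hu : u ≤ (a : ℝ) / ONE) : √u ≤ (sqrtU a : ℝ) / ONE := by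
  have h0 : √u ≤ √((a : ℝ) / ONE) := Real.sqrt_le_sqrt hu
  refine h0.trans ?_
  rw [sqrt_fp, div_le_div_iff_of_pos_right ONE_facts.1]
  unfold sqrtU
  set n := a * ONE with hn
  set s := isqrtC n
  split_ifs with h
  · have : (n : ℝ) < ((s + 1 : ℕ) : ℝ) ^ 2 := by exact_mod_cast (by nlinarith [h] : n < (s + 1) ^ 2)
    have hs : (0 : ℝ) ≤ ((s + 1 : ℕ) : ℝ) := Nat.cast_nonneg _
    calc √(n : ℝ) ≤ √(((s + 1 : ℕ) : ℝ) ^ 2) := Real.sqrt_le_sqrt this.le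
      _ = ((s + 1 : ℕ) : ℝ) := Real.sqrt_sq hs
  · have hs : (0 : ℝ) ≤ ((n + 1 : ℕ) : ℝ) := Nat.cast_nonneg _
    have : (n : ℝ) ≤ ((n + 1 : ℕ) : ℝ) ^ 2 := by
      push_cast; nlinarith [Nat.cast_nonneg (α := ℝ) n]
    calc √(n : ℝ) ≤ √(((n + 1 : ℕ) : ℝ) ^ 2) := Real.sqrt_le_sqrt this
      _ = ((n + 1 : ℕ) : ℝ) := Real.sqrt_sq hs

/-- Soundness of `sqrtD`: a lower bound of the square root. -/
theorem sqrtD_le (a : ℕ) : (sqrtD a : ℝ) / ONE ≤ √((a : ℝ) / ONE) := by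
  rw [sqrt_fp, div_le_div_iff_of_pos_right ONE_facts.1]
  unfold sqrtD
  set n := a * ONE with hn
  set s := isqrtC n
  split_ifs with h
  · have : ((s : ℕ) : ℝ) ^ 2 ≤ (n : ℝ) := by exact_mod_cast (by nlinarith [h] : s ^ 2 ≤ n)
    calc (s : ℝ) = √((s : ℝ) ^ 2) := (Real.sqrt_sq (Nat.cast_nonneg _)).symm
      _ ≤ √(n : ℝ) := Real.sqrt_le_sqrt this
  · simp

/-- A lower bound of every element and of the seed is a lower bound of `foldr min`. -/
theorem le_foldr_min {x : ℝ} (l : List ℕ) (init : ℕ) (hinit : x ≤ (init : ℝ) / ONE)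
    (hall : ∀ a ∈ l, x ≤ (a : ℝ) / ONE) : x ≤ ((l.foldr min init : ℕ) : ℝ) / ONE := by
  induction l with
  | nil => simpa using hinit
  | cons a l ih =>
    simp only [List.foldr_cons]
    have ha := hall a (by simp)
    have hl := ih (fun b hb => hall b (by simp [hb]))
    rcases le_total a (List.foldr min init l) with h | h
    · rw [min_eq_left h]; exact ha
    · rw [min_eq_right h]; exact hl

/-- Soundness of `sqrtTangU`. -/
theorem sqrtTangU_ge {P : ℕ} {p : ℝ} (hp0 : 0 ≤ p) (hp : p ≤ (P : ℝ) / ONE) :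
    √p ≤ (sqrtTangU P : ℝ) / ONE := by
  -- tangent inequality `√p ≤ (p + t²)/(2t)` (`t > 0`), from `(√p − t)² ≥ 0`
  have sqrt_le_tangent : ∀ {t : ℝ}, 0 < t → √p ≤ (p + t ^ 2) / (2 * t) := by
    intro t ht
    rw [le_div_iff₀ (by positivity)]
    have h := Real.sq_sqrt hp0
    nlinarith [sq_nonneg (√p - t), Real.sqrt_nonneg p]
  unfold sqrtTangU
  apply le_foldr_min
  · -- seed: √p ≤ p + 1 ≤ (P + ONE)/ONE
    have h1 : √p ≤ (p + 1 ^ 2) / (2 * 1) := sqrt_le_tangent zero_lt_one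
    have h2 : (p + 1 ^ 2) / (2 * 1) ≤ p + 1 := by nlinarith
    have h3 : p + 1 ≤ ((P + ONE : ℕ) : ℝ) / ONE := by
      push_cast; rw [add_div, div_self ONE_facts.2.1]; linarith
    linarith
  · intro a ha
    simp only [List.mem_map, List.mem_range] at ha
    obtain ⟨i, hi, rfl⟩ := ha
    have ht : (0 : ℝ) < ((i : ℝ) + 1) / 8 := by positivity
    have h1 := sqrt_le_tangent ht
    refine h1.trans ?_
    have hpos : (0 : ℕ) < 64 * (i + 1) := by positivity
    have h2 := div_le_cdiv (4 * (64 * P + (i + 1) ^ 2 * ONE)) (64 * (i + 1)) hpos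
    rw [le_div_iff₀ ONE_facts.1]
    refine le_trans ?_ h2
    rw [le_div_iff₀ (by exact_mod_cast hpos)]
    have hP : p * ONE ≤ (P : ℝ) := by rwa [le_div_iff₀ ONE_facts.1] at hp
    push_cast
    have hO := ONE_facts.1
    -- (p + t²)/(2t) · ONE · 64(i+1) = 4·(64 p ONE + (i+1)² ONE) ≤ 4(64 P + (i+1)² ONE)
    have : (p + (((i : ℝ) + 1) / 8) ^ 2) / (2 * (((i : ℝ) + 1) / 8)) * (ONE : ℝ) * (64 * ((i : ℝ) + 1))
        = 4 * (64 * (p * ONE) + ((i : ℝ) + 1) ^ 2 * ONE) := by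
      field_simp; ring
    rw [this]
    nlinarith


/-! ### List bookkeeping -/

/-- Entries of the memo list `btListx`. -/
theorem btListx_getD {d x i : ℕ} (hi : 2 ≤ i) (hiK : i < KK) :
    (btListx d x).getD (i - 2) 0 = btUx d x (i + 1) := by
  unfold btListx
  have h : i - 2 < KK - 2 := by unfold KK at *; omega
  rw [List.getD_eq_getElem?_getD, List.getElem?_map, List.getElem?_range h, Option.map_some, Option.getD_some]
  congr 1; omega

/-- The table at `n + 1` extends the table at `n`. -/
theorem etTab_succ (bts : List ℕ) (T n : ℕ) :
    etTab bts T (n + 1) = (if n + 1 < 3 then 0 else etStep bts T (etTab bts T n) (n + 1)) :: etTab bts T n := rfl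

/-- Random access into the reversed memo table. -/
theorem etTab_getD (bts : List ℕ) (T : ℕ) : ∀ n i, i ≤ n → (etTab bts T n).getD i 0 = etU bts T (n - i) := by
  intro n
  induction n with
  | zero =>
    intro i hi
    have hi0 : i = 0 := by omega
    subst hi0
    simp only [etTab, etU, Nat.sub_zero, List.getD_cons_zero, List.headD_cons]
  | succ n ih =>
    intro i hi
    cases i with
    | zero =>
      simp only [Nat.sub_zero, etU, etTab, List.getD_cons_zero, List.headD_cons]
    | succ i =>
      have h1 : (etTab bts T (n + 1)).getD (i + 1) 0 = (etTab bts T n).getD i 0 := by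
        simp only [etTab, List.getD_cons_succ]
      rw [h1, ih i (by omega)]
      congr 1; omega

/-- The table at `0`. -/
theorem etTab_zero (bts : List ℕ) (T : ℕ) : etTab bts T 0 = [ONE] := rfl

/-- `ẽ⁺_0 = ONE`. -/
theorem etU_zero (bts : List ℕ) (T : ℕ) : etU bts T 0 = ONE := by
  unfold etU; rw [etTab_zero]; rfl

/-- `ẽ⁺_{n+1}` is the step value. -/
theorem etU_succ (bts : List ℕ) (T n : ℕ) :
    etU bts T (n + 1) = (if n + 1 < 3 then 0 else etStep bts T (etTab bts T n) (n + 1)) := by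
  unfold etU; rw [etTab_succ]; rfl

/-- Members of `take` come from low indices. -/
theorem getD_mem_take {l : List ℕ} {n i : ℕ} (hi : i < n) (hil : i < l.length) : l.getD i 0 ∈ l.take n := by
  rw [List.getD_eq_getElem?_getD, List.getElem?_eq_getElem hil, Option.getD_some]
  exact List.mem_take_iff_getElem.mpr ⟨i, by simp [hi, hil], by simp⟩

/-- Length of the memo table. -/
theorem etTab_length (bts : List ℕ) (T : ℕ) : ∀ n, (etTab bts T n).length = n + 1 := by
  intro n; induction n with
  | zero => rfl
  | succ n ih => rw [etTab_succ, List.length_cons, ih]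

end Summit.RiemannHypothesis.RiemannHypothesis.Theorems.JensenPolynomials.CapCert
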